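import Mathlib.Analysis.SpecialFunctions.Pow.Real

/-!
# Helper `helper_handlebodyChart_modelHandles` (M3: handle structure of the model dotted handlebody `D_k`)
# of line `mk_friends` for crux `DcrGap` — handle charts, part 3: planar inequalities of the tubes
(item stmt-SmoothPoincare4-16128, route route-SmoothPoincare4-DottedCircleRasmussen)

Towards the registered stub `helper_handlebodyChart_modelHandles_data_part1`.  In the frame of the unit vector
`d_j = (c_j - z₀)/V` (`V = |c_j - z₀| ≥ 20`) a point of handle tube `j` is `z₀ + d_j · r' (V + i m)/σ`,
`σ = √(V² + m²)`, i.e. has frame coordinates `x = r' V/σ` (along `d_j`) and `y = r' m/σ` (lateral), where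
`(r', m)` is (up to the factor `√(1 - |w̃|²) ≈ 1`) the value of the planar tube map; the hole centre `c_j` has
frame coordinates `(V, 0)`.  This file collects the elementary real inequalities about the squared distance
`d² = (x - V)² + y²` to the hole and the lateral ratio `V |m| / σ` that drive containment in `D_k`, the
branch cuts of the angle lifts and the cover of the arches:

* `ModelHandles.holeDist_sq_eq`: `d² = (r' - V²/σ)² + V² m²/σ²`;
* `ModelHandles.holeDist_sq_lower`: on the tube (legs `m² = b²`, or bend `m² = b² c²`, `s² + c² = 1`, `s ≥ 0`,
  `r' ≥ V + b s - 1/100`) `d² ≥ b² - b/50 - b⁴/V²`; hence `d ≥ 27/20` for widths `b ≥ 1.39`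
  (`ModelHandles.holeDist_ge`) and `d > 41/25` on the outer boundary curve `b = 1.757`
  (`ModelHandles.outer_not_cap`);
* `ModelHandles.lateral_leg_gt`, `ModelHandles.outer_bend_radius`: the outer boundary curve misses the leg
  wedges `8/5 ≤ V|m|/σ ≤ 41/25`, `r' ≤ V + 1/2` of the arch;
* `ModelHandles.inner_not_cap`, `ModelHandles.lateral_le`: the inner boundary curve `b = 1.415` has `d < 8/5`
  wherever `x - V ≥ -7/10`, and lateral ratio `< 8/5`.

Registered summary `helper_handlebodyChart_modelHandles_tubeGeometry`.  No definitions, no named facts,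
no `sorry`.  References: R. Kirby, *The Topology of 4-Manifolds*, LNM 1374 (1989), Ch. I §2 [Kirby1989].
-/

-- the prescribed namespace `Summit.<P>.<Sub>.…` duplicates `SmoothPoincare4` (P = Sub)
set_option linter.dupNamespace false
set_option linter.style.longLine false
noncomputable section

namespace Summit.SmoothPoincare4.SmoothPoincare4.Theorems.DcrGap.MkFriends

namespace ModelHandles

/-! ## The frame norm `σ = √(V² + m²)` -/

/-- `σ = √(V² + m²)` satisfies `σ² = V² + m²`, `0 < σ`, `V ≤ σ ≤ V + m²/(2V)` (`V > 0`). [folklore] -/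
theorem sigma_props {V m : ℝ} (hV : 0 < V) :
    Real.sqrt (V ^ 2 + m ^ 2) ^ 2 = V ^ 2 + m ^ 2 ∧ 0 < Real.sqrt (V ^ 2 + m ^ 2) ∧
      V ≤ Real.sqrt (V ^ 2 + m ^ 2) ∧ Real.sqrt (V ^ 2 + m ^ 2) ≤ V + m ^ 2 / (2 * V) := by
  have h2 : Real.sqrt (V ^ 2 + m ^ 2) ^ 2 = V ^ 2 + m ^ 2 := Real.sq_sqrt (by positivity)
  have hpos : 0 < Real.sqrt (V ^ 2 + m ^ 2) := Real.sqrt_pos.2 (by positivity)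
  refine ⟨h2, hpos, ?_, ?_⟩
  · calc V = Real.sqrt (V ^ 2) := (Real.sqrt_sq hV.le).symm
      _ ≤ Real.sqrt (V ^ 2 + m ^ 2) := Real.sqrt_le_sqrt (by nlinarith)
  · apply Real.sqrt_le_iff.2
    refine ⟨by positivity, ?_⟩
    have : (V + m ^ 2 / (2 * V)) ^ 2 = V ^ 2 + m ^ 2 + (m ^ 2 / (2 * V)) ^ 2 := by
      field_simp; ring
    nlinarith [sq_nonneg (m ^ 2 / (2 * V))]

/-! ## The squared distance to the hole -/

/-- **The squared distance to the hole**: with `σ² = V² + m²`,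
`(r' V/σ - V)² + (r' m/σ)² = (r' - V²/σ)² + V² m²/σ²`. [folklore] -/
theorem holeDist_sq_eq {V m σ : ℝ} (hσ : σ ^ 2 = V ^ 2 + m ^ 2) (hσpos : 0 < σ) (r' : ℝ) :
    (r' * V / σ - V) ^ 2 + (r' * m / σ) ^ 2 = (r' - V ^ 2 / σ) ^ 2 + V ^ 2 * m ^ 2 / σ ^ 2 := by
  field_simp
  nlinarith [hσ]

/-- **Lower bound for the distance to the hole along the tube**: in the leg regime (`m² = b²`) and in the bend
regime (`m² = b² c²`, `s² + c² = 1`, `s ≥ 0`, `r' ≥ V + b s - 1/100`), `d² ≥ b² - b/50 - b⁴/V²`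
(`V > 0`, `b > 1/100`). [folklore] -/
theorem holeDist_sq_lower {V m σ b r' : ℝ} (hV : 0 < V) (hσ : σ ^ 2 = V ^ 2 + m ^ 2) (hσpos : 0 < σ)
    (hVσ : V ≤ σ) (hb : 1 / 100 < b)
    (hreg : m ^ 2 = b ^ 2 ∨ ∃ s c : ℝ, m ^ 2 = b ^ 2 * c ^ 2 ∧ s ^ 2 + c ^ 2 = 1 ∧ 0 ≤ s ∧ V + b * s - 1 / 100 ≤ r') :
    b ^ 2 - b / 50 - b ^ 4 / V ^ 2 ≤ (r' * V / σ - V) ^ 2 + (r' * m / σ) ^ 2 := by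
  rw [holeDist_sq_eq hσ hσpos]
  have hσ2 : 0 < σ ^ 2 := by positivity
  have hV0 : V ≠ 0 := hV.ne'
  have hb0 : 0 < b := lt_trans (by norm_num) hb
  -- the lateral term: `V² m²/σ² ≥ m² - m⁴/V²`
  have hlat : m ^ 2 - m ^ 4 / V ^ 2 ≤ V ^ 2 * m ^ 2 / σ ^ 2 := by
    have hm6 : 0 ≤ m ^ 6 := by positivity
    rw [show m ^ 2 - m ^ 4 / V ^ 2 = (m ^ 2 * V ^ 2 - m ^ 4) / V ^ 2 by field_simp,
      div_le_div_iff₀ (by positivity) hσ2, hσ]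
    nlinarith [hm6]
  have hVσ' : V ^ 2 / σ ≤ V := by rw [div_le_iff₀ hσpos]; nlinarith
  rcases hreg with hm | ⟨s, c, hm, hsc, hs, hr⟩
  · -- legs: drop the first square
    have h4 : m ^ 4 = b ^ 4 := by rw [show m ^ 4 = (m ^ 2) ^ 2 by ring, hm]; ring
    rw [hm, h4] at hlat
    rw [hm]
    have hsq := sq_nonneg (r' - V ^ 2 / σ)
    have : 0 ≤ b / 50 := by positivity
    linarith
  · have hc2 : c ^ 2 ≤ 1 := by nlinarith
    have hs1 : s ≤ 1 := by nlinarith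
    have hbc : b ^ 2 * c ^ 2 = b ^ 2 - b ^ 2 * s ^ 2 := by linear_combination b ^ 2 * hsc
    have hm4 : m ^ 4 ≤ b ^ 4 := by
      have e : m ^ 4 = b ^ 4 * c ^ 4 := by rw [show m ^ 4 = (m ^ 2) ^ 2 by ring, hm]; ring
      rw [e]
      have hc4 : c ^ 4 ≤ 1 := by nlinarith [sq_nonneg c]
      have hb4 : 0 < b ^ 4 := by positivity
      nlinarith
    have hlat' : b ^ 2 * c ^ 2 - b ^ 4 / V ^ 2 ≤ V ^ 2 * m ^ 2 / σ ^ 2 := by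
      have : m ^ 4 / V ^ 2 ≤ b ^ 4 / V ^ 2 := div_le_div_of_nonneg_right hm4 (by positivity)
      rw [hm] at hlat ⊢; linarith
    -- the radial term: `r' - V²/σ ≥ b s - 1/100`
    have hrad : b * s - 1 / 100 ≤ r' - V ^ 2 / σ := by linarith
    have hbs0 : 0 ≤ b * s := mul_nonneg hb0.le hs
    rcases le_or_gt (1 / 100) (b * s) with hbs | hbs
    · have hsq : (b * s - 1 / 100) ^ 2 ≤ (r' - V ^ 2 / σ) ^ 2 := pow_le_pow_left₀ (by linarith) hrad 2
      have key : b ^ 2 - b / 50 - b ^ 4 / V ^ 2 ≤ (b * s - 1 / 100) ^ 2 + (b ^ 2 * c ^ 2 - b ^ 4 / V ^ 2) := by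
        have h1 : (b * s - 1 / 100) ^ 2 = b ^ 2 * s ^ 2 - b * s / 50 + 1 / 10000 := by ring
        rw [h1, hbc]
        nlinarith [mul_nonneg hb0.le (sub_nonneg.2 hs1)]
      linarith
    · -- tiny `s`: `b² s² < 1/10000 ≤ b/50`
      have hbs2 : b ^ 2 * s ^ 2 < 1 / 10000 := by nlinarith
      have hsq := sq_nonneg (r' - V ^ 2 / σ)
      rw [hbc] at hlat'
      nlinarith

/-- **The tube keeps distance `≥ 27/20` from its hole** (widths `1.39 ≤ b ≤ 1.78`, `V ≥ 20`). [folklore] -/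
theorem holeDist_ge {V m σ b r' : ℝ} (hV : 20 ≤ V) (hσ : σ ^ 2 = V ^ 2 + m ^ 2) (hσpos : 0 < σ) (hVσ : V ≤ σ)
    (hb1 : 139 / 100 ≤ b) (hb2 : b ≤ 178 / 100)
    (hreg : m ^ 2 = b ^ 2 ∨ ∃ s c : ℝ, m ^ 2 = b ^ 2 * c ^ 2 ∧ s ^ 2 + c ^ 2 = 1 ∧ 0 ≤ s ∧ V + b * s - 1 / 100 ≤ r') :
    (27 / 20 : ℝ) ^ 2 ≤ (r' * V / σ - V) ^ 2 + (r' * m / σ) ^ 2 := by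
  have h := holeDist_sq_lower (by linarith) hσ hσpos hVσ (by linarith) hreg
  have hb4 : b ^ 4 / V ^ 2 ≤ b ^ 2 * (178 / 100) ^ 2 / 400 := by
    rw [div_le_div_iff₀ (by positivity) (by norm_num)]
    have h1 : b ^ 2 ≤ (178 / 100) ^ 2 := by nlinarith
    have h2 : (400 : ℝ) ≤ V ^ 2 := by nlinarith
    have h3 : b ^ 2 * 400 ≤ (178 / 100) ^ 2 * V ^ 2 := mul_le_mul h1 h2 (by norm_num) (by positivity)
    nlinarith [mul_le_mul_of_nonneg_left h3 (sq_nonneg b)]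
  have hb2sq : (139 / 100 : ℝ) ^ 2 ≤ b ^ 2 := by nlinarith
  nlinarith

/-- **The outer boundary curve (`b = 1.757`) stays at distance `> 41/25` from the hole.** [folklore] -/
theorem outer_not_cap {V m σ r' : ℝ} (hV : 20 ≤ V) (hσ : σ ^ 2 = V ^ 2 + m ^ 2) (hσpos : 0 < σ) (hVσ : V ≤ σ)
    (hreg : m ^ 2 = (1757 / 1000) ^ 2 ∨ ∃ s c : ℝ, m ^ 2 = (1757 / 1000) ^ 2 * c ^ 2 ∧ s ^ 2 + c ^ 2 = 1 ∧ 0 ≤ s ∧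
      V + 1757 / 1000 * s - 1 / 100 ≤ r') :
    (41 / 25 : ℝ) ^ 2 < (r' * V / σ - V) ^ 2 + (r' * m / σ) ^ 2 := by
  have h := holeDist_sq_lower (b := 1757 / 1000) (by linarith) hσ hσpos hVσ (by norm_num) hreg
  have hb4 : (1757 / 1000 : ℝ) ^ 4 / V ^ 2 ≤ (1757 / 1000) ^ 4 / 400 :=
    div_le_div_of_nonneg_left (by positivity) (by norm_num) (by nlinarith)
  nlinarith

/-! ## The lateral ratio `V |m| / σ` -/

/-- **On a leg of width `b ≥ 1.757` the lateral ratio exceeds `41/25`**: `(41/25)² σ² < V² m²` for `m² = b²`,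
`V ≥ 20`. [folklore] -/
theorem lateral_leg_gt {V m σ b : ℝ} (hV : 20 ≤ V) (hσ : σ ^ 2 = V ^ 2 + m ^ 2) (hb : 1757 / 1000 ≤ b)
    (hm : m ^ 2 = b ^ 2) : (41 / 25 : ℝ) ^ 2 * σ ^ 2 < V ^ 2 * m ^ 2 := by
  rw [hσ, hm]
  have hb2 : (1757 / 1000 : ℝ) ^ 2 ≤ b ^ 2 := by nlinarith
  have hV2 : (400 : ℝ) ≤ V ^ 2 := by nlinarith
  have key := mul_le_mul_of_nonneg_right hb2 (sub_nonneg.2 (by linarith : ((41 / 25 : ℝ)) ^ 2 ≤ V ^ 2))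
  nlinarith

/-- **On the bend of the outer curve the leg band is only met beyond `r' = V + 1/2`**: if
`V² m² ≤ (41/25)² σ²` with `m² = b² c²`, `b = 1.757`, then `s ≥ 0.34`, so `r' > V + 1/2`. [folklore] -/
theorem outer_bend_radius {V m σ r' s c : ℝ} (hV : 20 ≤ V) (hσ : σ ^ 2 = V ^ 2 + m ^ 2)
    (hm : m ^ 2 = (1757 / 1000) ^ 2 * c ^ 2) (hsc : s ^ 2 + c ^ 2 = 1) (hs : 0 ≤ s)
    (hr : V + 1757 / 1000 * s - 1 / 100 ≤ r') (hlat : V ^ 2 * m ^ 2 ≤ (41 / 25 : ℝ) ^ 2 * σ ^ 2) :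
    V + 1 / 2 < r' := by
  rw [hσ, hm] at hlat
  -- `c² ≤ 0.88`, so `s² ≥ 0.12`, so `s ≥ 0.34`
  have hV2 : (400 : ℝ) ≤ V ^ 2 := by nlinarith
  have hc2 : c ^ 2 ≤ 88 / 100 := by
    by_contra h
    push Not at h
    have key := mul_le_mul h.le hV2 (by norm_num) (sq_nonneg c)
    nlinarith
  have hs2 : (34 / 100 : ℝ) ^ 2 ≤ s ^ 2 := by nlinarith
  have hs34 : 34 / 100 ≤ s := by nlinarith
  linarith

/-- **The lateral ratio is at most `|m|`**: a curve of width `≤ b < 8/5` has ratio `< 8/5`: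
`V² m² < (8/5)² σ²` for `m² ≤ b²`, `V > 0`. [folklore] -/
theorem lateral_lt {V m σ b : ℝ} (hV : 0 < V) (hσ : σ ^ 2 = V ^ 2 + m ^ 2) (hb : b < 8 / 5) (hb0 : 0 ≤ b)
    (hm : m ^ 2 ≤ b ^ 2) : V ^ 2 * m ^ 2 < (8 / 5 : ℝ) ^ 2 * σ ^ 2 := by
  rw [hσ]
  have hb2 : b ^ 2 < (8 / 5) ^ 2 := by nlinarith
  have h1 := mul_le_mul_of_nonneg_left hm (sq_nonneg V)
  have h2 := mul_lt_mul_of_pos_left hb2 (pow_pos hV 2)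
  nlinarith [sq_nonneg m]

/-! ## The inner boundary curve -/

/-- **The inner boundary curve (`b = 1.415`) does not meet the cap**: wherever its frame coordinate satisfies
`x - V ≥ -7/10`, its distance to the hole is `< 8/5` — on the legs (`m² = b²`, `r' ≤ V`) because
`d² < 0.49 + b²`, on the bend (`m² = b² c²`, `V + b s - 1/100 ≤ r' ≤ V + b s`) because
`d² ≤ (b s + 0.06)² + b² c²` (`V ≥ 20`). [folklore] -/
theorem inner_not_cap {V m σ r' : ℝ} (hV : 20 ≤ V) (hσ : σ ^ 2 = V ^ 2 + m ^ 2) (hσpos : 0 < σ) (hVσ : V ≤ σ)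
    (hσV : σ ≤ V + m ^ 2 / (2 * V)) (hr0 : 0 ≤ r')
    (hreg : (m ^ 2 = (1415 / 1000) ^ 2 ∧ r' ≤ V) ∨ ∃ s c : ℝ, m ^ 2 = (1415 / 1000) ^ 2 * c ^ 2 ∧ s ^ 2 + c ^ 2 = 1 ∧
      0 ≤ s ∧ V + 1415 / 1000 * s - 1 / 100 ≤ r' ∧ r' ≤ V + 1415 / 1000 * s)
    (hx : -(7 / 10) ≤ r' * V / σ - V) :
    (r' * V / σ - V) ^ 2 + (r' * m / σ) ^ 2 < (8 / 5 : ℝ) ^ 2 := by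
  have hV0 : 0 < V := by linarith
  have hσ2 : 0 < σ ^ 2 := by positivity
  rcases hreg with ⟨hm, hrV⟩ | ⟨s, c, hm, hsc, hs, hr1, hr2⟩
  · -- legs: `x ≤ r' ≤ V`, `y² < b²`
    have hrσ : r' ≤ σ := hrV.trans hVσ
    have hx0 : r' * V / σ - V ≤ 0 := by
      rw [sub_nonpos, div_le_iff₀ hσpos]
      exact mul_le_mul_of_nonneg_right hrσ hV0.le |>.trans_eq (mul_comm _ _)
    have hxsq : (r' * V / σ - V) ^ 2 ≤ (7 / 10) ^ 2 := by nlinarith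
    have hysq : (r' * m / σ) ^ 2 < (1415 / 1000) ^ 2 := by
      rw [div_pow, mul_pow, div_lt_iff₀ hσ2, hm]
      have hr2 : r' ^ 2 ≤ V ^ 2 := pow_le_pow_left₀ hr0 hrV 2
      have hVσ2 : V ^ 2 < σ ^ 2 := by rw [hσ, hm]; norm_num
      nlinarith
    nlinarith
  · rw [holeDist_sq_eq hσ hσpos]
    have hc2 : c ^ 2 ≤ 1 := by nlinarith
    have hs1 : s ≤ 1 := by nlinarith
    have hm2 : m ^ 2 ≤ (1415 / 1000) ^ 2 := by rw [hm]; nlinarith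
    -- lateral term `≤ m² = b² c²`
    have hlat : V ^ 2 * m ^ 2 / σ ^ 2 ≤ (1415 / 1000) ^ 2 * c ^ 2 := by
      rw [div_le_iff₀ hσ2, ← hm, hσ]
      nlinarith [sq_nonneg (m ^ 2)]
    -- radial term: `-1/100 ≤ r' - V²/σ ≤ b s + m²/(2V) ≤ b s + 0.06`
    have hVσ' : V ^ 2 / σ ≤ V := by rw [div_le_iff₀ hσpos]; nlinarith
    have he0 : 0 ≤ m ^ 2 / (2 * V) := by positivity
    have he1 : m ^ 2 / (2 * V) ≤ 6 / 100 := by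
      rw [div_le_iff₀ (by positivity)]; nlinarith
    have hVσ'' : V - m ^ 2 / (2 * V) ≤ V ^ 2 / σ := by
      rw [le_div_iff₀ hσpos]
      have h1 : (V - m ^ 2 / (2 * V)) * σ ≤ (V - m ^ 2 / (2 * V)) * (V + m ^ 2 / (2 * V)) :=
        mul_le_mul_of_nonneg_left hσV (by linarith)
      have h2 : (V - m ^ 2 / (2 * V)) * (V + m ^ 2 / (2 * V)) ≤ V ^ 2 := by
        nlinarith [sq_nonneg (m ^ 2 / (2 * V))]
      linarith
    have hlo : -(1415 / 1000 * s + 6 / 100) ≤ r' - V ^ 2 / σ := by nlinarith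
    have hhi : r' - V ^ 2 / σ ≤ 1415 / 1000 * s + 6 / 100 := by linarith
    have hrad : (r' - V ^ 2 / σ) ^ 2 ≤ (1415 / 1000 * s + 6 / 100) ^ 2 := sq_le_sq' hlo hhi
    have key : (1415 / 1000 * s + 6 / 100) ^ 2 + (1415 / 1000) ^ 2 * c ^ 2 ≤ 22 / 10 := by
      have hsc' : (1415 / 1000 : ℝ) ^ 2 * c ^ 2 = (1415 / 1000) ^ 2 - (1415 / 1000) ^ 2 * s ^ 2 := by
        linear_combination (1415 / 1000 : ℝ) ^ 2 * hsc
      rw [hsc']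
      nlinarith
    nlinarith

end ModelHandles

/-- **Registered piece `helper_handlebodyChart_modelHandles_tubeGeometry` of the data stub, part 1 (planar
inequalities of the handle tubes)**: in frame coordinates `x = r' V/σ`, `y = r' m/σ` (`σ² = V² + m²`, `V ≥ 20`)
the squared distance to the hole `(V, 0)` is `(r' - V²/σ)² + V² m²/σ²` and is `≥ (27/20)²` along a tube of width
`b ∈ [1.39, 1.78]` (legs `m² = b²`; bend `m² = b² c²`, `s² + c² = 1`, `s ≥ 0`, `r' ≥ V + b s - 1/100`)
(`ModelHandles.holeDist_sq_eq`, `ModelHandles.holeDist_ge`). [folklore] -/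
theorem helper_handlebodyChart_modelHandles_tubeGeometry : ∀ (V m σ b r' : ℝ), 20 ≤ V → σ ^ 2 = V ^ 2 + m ^ 2 → 0 < σ → V ≤ σ → 139 / 100 ≤ b → b ≤ 178 / 100 → (m ^ 2 = b ^ 2 ∨ ∃ s c : ℝ, m ^ 2 = b ^ 2 * c ^ 2 ∧ s ^ 2 + c ^ 2 = 1 ∧ 0 ≤ s ∧ V + b * s - 1 / 100 ≤ r') → (r' * V / σ - V) ^ 2 + (r' * m / σ) ^ 2 = (r' - V ^ 2 / σ) ^ 2 + V ^ 2 * m ^ 2 / σ ^ 2 ∧ (27 / 20 : ℝ) ^ 2 ≤ (r' * V / σ - V) ^ 2 + (r' * m / σ) ^ 2 :=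
  fun _ _ _ _ r' hV hσ hσpos hVσ hb1 hb2 hreg =>
    ⟨ModelHandles.holeDist_sq_eq hσ hσpos r', ModelHandles.holeDist_ge hV hσ hσpos hVσ hb1 hb2 hreg⟩

end Summit.SmoothPoincare4.SmoothPoincare4.Theorems.DcrGap.MkFriends

end
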